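import Literature.MathematicalPhysics.QuantumFieldTheory.Balaban1983to89.B5Hk163RDiv
import Literature.MathematicalPhysics.QuantumFieldTheory.Balaban1983to89.Beta.Ineq167OperatorUpper

/-!
# Bałaban 1984 (Propagators I, CMP 95), (1.65)/(1.66) for the typed `H_k` of (1.63), and (1.63) = (1.103)

T. Bałaban, *Propagators and renormalization transformations for lattice gauge theories. I*,
Commun. Math. Phys. **95** (1984) 17–40 (= [Balaban1984PropagatorsI]), Section D p. 29 (formulas
(1.65)–(1.67)) and Section F pp. 33–34 (formulas (1.91)–(1.103)).

## The audited sentences (verbatim, read from the page images)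

p. 29 [PDF 13] (render `…-p013-x2.png`): «The action Δ_k is thus defined by ⟨B, Δ_kB⟩ = ⟨∂H_kB, ∂H_kB⟩.
(1.65) Using formulas (1.60) or (1.63) we obtain the following expression
⟨B, Δ_kB⟩ = ½Σ_{μ,ν}⟨(∂¹_μB_ν − ∂¹_νB_μ), φ_μ⁻¹φ_ν⁻¹(∂₁*φ⁻¹∂₁)⁻¹(∂¹_μB_ν − ∂¹_νB_μ)⟩ = ⟨∂₁B, σ_k∂₁B⟩
= ½Σ_{μ,ν}(2π)^{−d}∫dp′ [1 / ((Σ_{λ=1}^{d} |∂¹_λ(p′)|²/(Δ₀²(p′)φ_λ(p′))) Δ₀(p′)φ_μ(p′)Δ₀(p′)φ_ν(p′))]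
|(∂₁B)~_{μν}(p′)|². (1.66) The function under the integral is bounded from below and above by positive
constants γ₀, γ₁ dependent on d only, so we have γ₀⟨∂₁B, ∂₁B⟩ ≦ ⟨B, Δ_kB⟩ ≦ γ₁⟨∂₁B, ∂₁B⟩. (1.67)».
No derivation of (1.66) is printed.

p. 33 [PDF 17] (render `…-p017-x2.png`): «Let us now come back to the integral (1.68) and to a calculation
of H_kB. It is defined as a minimum of the form ½⟨A, Δ_aA⟩ − a⟨B, B⟩ under the conditions QA = B,
R∂*A = 0.»;  p. 34 [PDF 18] (render `…-p018-x2.png`): «The condition QA = B gives the equation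
−QGQ*ω = B, −ω = (QGQ*)⁻¹B, (1.102) so finally we get the representation H_kB = GQ*(QGQ*)⁻¹B. (1.103)
This representation allows us to reduce a proof of properties of H_k to the corresponding properties of G.»

## What this module certifies (torus model of the lineage; every `n ≥ 1`, every torus `M`, every `d`)

Three typed objects of three lineages of this package are identified:
* `B5Hk163Torus.HkOp n M` — the operator `H_k` of (1.58) through its MOMENTUM REPRESENTATION (1.63)
  (lineage b05; `Q_kH_kB = B`, `R∂*H_kB = 0`, the minimum property and its uniqueness are
  `B5Hk163Torus.QvOp_HkOp_mulVec`, `B5Hk163RDiv.R_divS_HkOp`, `B5Hk163RDiv.eq_HkOp_iff_minimum`);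
* `Beta.FluctuationProjection.Hk n hn M a ha := G·Q*·(QGQ*)⁻¹` — the operator of (1.103) (β sub-cell),
  with the (1.65) operator `Beta.BlockEffectiveAction.DelK := n^{-d}·H_kᴴ(½(CurlOp)ᴴCurlOp)H_k`;
* `B5Bounds167Lattice.formDk n M B := ½Σ_{μ,ν}Σ_{p′} w166(p′)|(∂₁B)~_{μν}(p′)|²` — `⟨B, Δ_kB⟩` AS GIVEN BY
  THE THIRD EXPRESSION OF (1.66) (lineage pv15), for which (1.67) is `B5Bounds167Lattice.ineq167`.

PROVED HERE (zero `sorry`; everything is finite-dimensional algebra over kernel theorems of the package —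
[folklore] junctions; NO printed statement enters as a hypothesis, ABSOLUTE RULE):
* §1 (symbol-agnostic) `lagrange_weighted` — the weighted Lagrange identity
  `(Σ_λ ω_λ|d_λ|²)(Σ_κ ω_κ|B_κ|²) − |Σ_κ ω_κ d̄_κB_κ|² = ½Σ_{μ,ν} ω_μω_ν|d_μB_ν − d_νB_μ|²`, and
  **`sum_conj_mul_wSym`**: with `w_μ = B_μ/φ_μ − ∂¹_μN⁻¹t/(Δ₀φ_μ)`, `t = Σ_λ \overline{∂¹_λ}B_λ/(Δ₀φ_λ)`,
  `N = Σ_ν|∂¹_ν|²/(Δ₀²φ_ν)` (the symbols of `B5Symbol163`/`B5Hk163RDiv`):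
  `Σ_κ B̄_κ w_κ = ½Σ_{μ,ν} |∂¹_μB_ν − ∂¹_νB_μ|² / (N·Δ₀²·φ_μ·φ_ν)`; §2 `w166_cast`, **`sum_conj_mul_wT`**:
  on the torus leaves this weight IS pv15's `w166` («the function under the integral in (1.66)»), and
  `w166_eq_first`: the weight of the FIRST expression of (1.66), `φ_μ⁻¹φ_ν⁻¹(Σ_λ|∂¹_λ|²/φ_λ)⁻¹`, equals the
  weight of the THIRD (the `Δ₀²` cancel) — the printed chain of equalities in (1.66) at symbol level.
* §3 **`form_DstarD_HkOp`: `⟨H_kB, ∂*∂H_kB⟩ = n^d·formDk n M B`** for the typed (1.63)-operator, i.e.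
  (with `B5Hk163RDiv.form_DstarD`, (1.21)) **`half_sum_Fs_HkOp : ½Σ_{x,μ,ν}|F^η_{μν}(H_kB)(x)|² = n^d·formDk B`** —
  THE PRINTED SENTENCE «Using formulas (1.60) or (1.63) we obtain the following expression (1.66)» for the
  typed objects (the factor `n^d = c_Q⁻²` is the ratio of the two unitary DFT normalisations, equivalently
  the weight `η^d` of the scalar product (1.21), cf. `DelK_form_eq_formDk` below where it cancels exactly).
  Proof = the paper's «Using (1.63)»: Parseval (`B5Hk163RDiv.parseval_dftV`), the fibrewise symbol of
  `∂*∂H_kB` (`B5Hk163RDiv.dftV_DstarD_HkOp_of_ne/_zero`: `c_Q⁻¹·\overline{u v_κ}·w_κ(p′)` resp. `0`), the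
  momentum form (1.61) of `Q_k` (`B5Block118.dft_QvOp`) AT `A := H_kB` together with `Q_kH_kB = B`
  (`sum_uv_dft_HkOp`: `Σ_l u v_κ (H_kB)^_κ(p′+l) = c_Q⁻¹B̂_κ(p′)`), and §1–§2.
* §4 **`Hk_mulVec_eq_HkOp_mulVec`, `HkOp_eq_Hk : B5Hk163Torus.HkOp n M = Beta.FluctuationProjection.Hk n hn M a ha`**
  for EVERY `a > 0` — (1.63) and (1.103) define THE SAME operator (the content of p. 33 «a calculation of
  H_kB. It is defined as a minimum … under the conditions QA = B, R∂*A = 0» + (1.103)), by the uniqueness of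
  the minimiser on the printed hyperplane (`B5Hk163RDiv.HkOp_minimum_unique`) applied to `A := H^{(1.103)}B`,
  which lies on the hyperplane (`Beta.FluctuationProjection.QvOp_Hk_mulVec`, `R_div_Hk_mulVec`) and minimises
  the curl energy over `{QA = B}` (`Beta.BlockEffectiveAction.curl_energy_min`); `curl_energy_eq_two_mul_form`.
* §5 THE (1.65)↔(1.66) DICTIONARY, recorded as NOT claimed in `Beta.Ineq167Operator` / `Beta.Ineq167OperatorUpper`
  and in `B5Bounds167Lattice` (its NOT-claimed (1)): **`DelK_form_eq_formDk : Bᴴ·Δ_k·B = formDk n M B`** ON THE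
  NOSE (complex-valued; `DelK_form_re_eq_formDk` its real part), hence **`formOfDelK_eq_formOfLattice`**: the β
  cell's carrier of the GENUINE form (1.65) and pv15's carrier of the (1.66)-DEFINED form are EQUAL as
  `B5.FormData`; consequently (1.67) for `Δ_k` follows a second time from pv15's `ineq167` (`ineq167_DelK_via166`,
  constants `(4/π²)^{d+2}`, `(π²/4)^{2d+4}` — WEAKER than the β cell's `ineq167_DelK` (`γ₀ = 1`,
  `γ₁ = (π²/4)^{d+2}`), recorded only as the literal (1.66) road; conversely `ineq167_formDk_sharp` transports
  the β constants to pv15's `formDk`), and `formDk_le_of_QvOp_eq`: the (1.66)-form is dominated by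
  `n^{-d}·½Σ|F^η(A)|²` for every fine `A` with `Q_kA = B` (pv15's NOT-claimed (1) is thereby kernel-closed).

HONEST SCOPE.  Torus model throughout (fine torus `Π ℤ/(nM_μ)` over the unit torus `Π ℤ/M_μ`, `U = 1`,
`m² = 0`; `Δ⁻¹` inside `P` is the torus pseudo-inverse of the tree, as in the whole lineage); the momentum
integral `(2π)^{−d}∫dp′` of (1.66) is the finite torus sum with the unitary DFT (pv15's reading, by name).
NOT claimed: the Gaussian integral (1.64) itself; the operator `σ_k` of the second expression of (1.66) as a
typed operator (only its symbol weight, `w166_eq_first`); anything on the infinite lattice; Bałaban's own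
(unprinted) constants `γ₀`, `γ₁` of (1.67); anything about `β`, Proposition 1.2, the continuum limit.  Value = a junction
certificate identifying three typed objects of the package + the printed identity (1.66) for the typed
`H_k`; NOT summit progress; NOT the continuum limit; NOT Clay.

Unit `b2b-balaban-b05-g12` (PAPER SUB-CELL B05, gen 12), node HK163-FORM166 (GAPS residual G-b05g12-1);
staged byte-identically under `HOME/lean/BalabanYm4/`.
-/

noncomputable section

open scoped BigOperators Matrix ComplexConjugate
open Finset Complex

namespace Literature.MathematicalPhysics.QuantumFieldTheory.Balaban1983to89.B5Hk163Form166

open Literature.MathematicalPhysics.QuantumFieldTheory.Balaban1983to89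
open Literature.MathematicalPhysics.QuantumFieldTheory.Balaban1983to89.B5Symbol163 (nSym)
open Literature.MathematicalPhysics.QuantumFieldTheory.Balaban1983to89.B5Hk163RDiv (tSum wSym wT DstarD
  form_DstarD parseval_dftV dftV_DstarD_HkOp_of_ne dftV_DstarD_HkOp_zero HkOp_minimum_unique nSym_ne_zero
  d1Sym_ne_zero R_divS_HkOp)
open Literature.MathematicalPhysics.QuantumFieldTheory.Balaban1983to89.B4Strip (Delta1r)
open Literature.MathematicalPhysics.QuantumFieldTheory.Balaban1983to89.B5Prop11Plancherel (Tor dft dftV fine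
  sOf sOf_zero sOf_ne_zero abs_sOf_le)
open Literature.MathematicalPhysics.QuantumFieldTheory.Balaban1983to89.B5Prop11Fiber (d1Sym vSym uSym)
open Literature.MathematicalPhysics.QuantumFieldTheory.Balaban1983to89.B5Prop11Leaves (Delta1r_pos)
open Literature.MathematicalPhysics.QuantumFieldTheory.Balaban1983to89.B5Action121 (comp GradOp Fs CurlOp
  curl_adjoint_curl star_mulVec_dotProduct Lap_eq_LapV)
open Literature.MathematicalPhysics.QuantumFieldTheory.Balaban1983to89.B5Prop11Lower (Lap)
open Literature.MathematicalPhysics.QuantumFieldTheory.Balaban1983to89.B5Block118 (pOf cQ QvOp dft_QvOp)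
open Literature.MathematicalPhysics.QuantumFieldTheory.Balaban1983to89.B5Constraint130 (cQ_ne_zero)
open Literature.MathematicalPhysics.QuantumFieldTheory.Balaban1983to89.B5Hk163Torus (HkOp QvOp_HkOp_mulVec)
open Literature.MathematicalPhysics.QuantumFieldTheory.Balaban1983to89.B5Bounds167Lattice (phi162 w166 hat
  curlHat formDk d1Sq curlHat_eq_zero_of ineq167 formOfLattice)
open Literature.MathematicalPhysics.QuantumFieldTheory.Balaban1983to89.B5Action165Lagrange (phi162_pos)
open Literature.MathematicalPhysics.QuantumFieldTheory.Balaban1983to89.B5Value126 (PcT)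
open Literature.MathematicalPhysics.QuantumFieldTheory.Balaban1983to89.Beta.FluctuationProjection (Hk
  QvOp_Hk_mulVec R_div_Hk_mulVec)
open Literature.MathematicalPhysics.QuantumFieldTheory.Balaban1983to89.Beta.BlockEffectiveAction (DelK
  curl_energy_min)
open Literature.MathematicalPhysics.QuantumFieldTheory.Balaban1983to89.Beta.Ineq167Operator (curl_energy_eq_sum
  DelK_form_eq formOfDelK)
open Literature.MathematicalPhysics.QuantumFieldTheory.Balaban1983to89.Beta.Ineq167OperatorUpper (cQ_sq
  gamma1 ineq167_DelK)

variable {d : ℕ}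

/-! ## §1 The weighted Lagrange identity and the quadratic form of the symbol `w` -/

section Agnostic

variable {κ : Type*} [Fintype κ]

/-- the WEIGHTED LAGRANGE IDENTITY (polynomial identity; `ω` arbitrary):
`(Σ_λ ω_λ d̄_λd_λ)(Σ_κ ω_κ B̄_κB_κ) − (Σ_μ ω_μ d̄_μB_μ)(Σ_ν ω_ν d_νB̄_ν)
 = ½Σ_{μ,ν} ω_μω_ν \overline{(d_μB_ν − d_νB_μ)}(d_μB_ν − d_νB_μ)`. [folklore] -/
theorem lagrange_weighted (ω dd B : κ → ℂ) :
    (∑ lam, ω lam * (conj (dd lam) * dd lam)) * (∑ ka, ω ka * (conj (B ka) * B ka))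
        - (∑ mu, ω mu * (conj (dd mu) * B mu)) * (∑ nu, ω nu * (dd nu * conj (B nu)))
      = (1 / 2) * ∑ mu, ∑ nu, ω mu * ω nu
          * (conj (dd mu * B nu - dd nu * B mu) * (dd mu * B nu - dd nu * B mu)) := by
  have hX : ∑ mu, ∑ nu, ω mu * ω nu * (conj (dd nu) * dd nu * (conj (B mu) * B mu))
      = ∑ mu, ∑ nu, ω mu * ω nu * (conj (dd mu) * dd mu * (conj (B nu) * B nu)) := by
    rw [Finset.sum_comm]
    exact Finset.sum_congr rfl fun _ _ => Finset.sum_congr rfl fun _ _ => by ring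
  have hY : ∑ mu, ∑ nu, ω mu * ω nu * (conj (dd nu) * conj (B mu) * (dd mu * B nu))
      = ∑ mu, ∑ nu, ω mu * ω nu * (conj (dd mu) * conj (B nu) * (dd nu * B mu)) := by
    rw [Finset.sum_comm]
    exact Finset.sum_congr rfl fun _ _ => Finset.sum_congr rfl fun _ _ => by ring
  have hR : ∀ mu nu, ω mu * ω nu * (conj (dd mu * B nu - dd nu * B mu) * (dd mu * B nu - dd nu * B mu))
      = ω mu * ω nu * (conj (dd mu) * dd mu * (conj (B nu) * B nu))
        + ω mu * ω nu * (conj (dd nu) * dd nu * (conj (B mu) * B mu))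
        - ω mu * ω nu * (conj (dd mu) * conj (B nu) * (dd nu * B mu))
        - ω mu * ω nu * (conj (dd nu) * conj (B mu) * (dd mu * B nu)) := by
    intro mu nu
    simp only [map_sub, map_mul]
    ring
  have e1 : (∑ lam, ω lam * (conj (dd lam) * dd lam)) * (∑ ka, ω ka * (conj (B ka) * B ka))
      = ∑ mu, ∑ nu, ω mu * ω nu * (conj (dd mu) * dd mu * (conj (B nu) * B nu)) := by
    rw [Finset.sum_mul_sum]
    exact Finset.sum_congr rfl fun _ _ => Finset.sum_congr rfl fun _ _ => by ring
  have e2 : (∑ mu, ω mu * (conj (dd mu) * B mu)) * (∑ nu, ω nu * (dd nu * conj (B nu)))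
      = ∑ mu, ∑ nu, ω mu * ω nu * (conj (dd mu) * conj (B nu) * (dd nu * B mu)) := by
    rw [Finset.sum_mul_sum]
    exact Finset.sum_congr rfl fun _ _ => Finset.sum_congr rfl fun _ _ => by ring
  simp_rw [hR, Finset.sum_sub_distrib, Finset.sum_add_distrib]
  rw [hX, hY, e1, e2]
  ring

/-- **the quadratic form of the symbol `w`** (`B5Hk163RDiv.wSym`: `w_μ = B_μ/φ_μ − ∂¹_μN⁻¹t/(Δ₀φ_μ)`,
`t = Σ_λ \overline{∂¹_λ}B_λ/(Δ₀φ_λ)` = `B5Hk163RDiv.tSum`, `N = Σ_ν|∂¹_ν|²/(Δ₀²φ_ν)` = `B5Symbol163.nSym`):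
`Σ_κ B̄_κ w_κ = ½ Σ_{μ,ν} \overline{(∂¹_μB_ν − ∂¹_νB_μ)}(∂¹_μB_ν − ∂¹_νB_μ) / (N·Δ₀²·φ_μ·φ_ν)`
(`Δ₀`, `N` invertible — with Lean's `x/0 = 0` no hypothesis on `φ` is needed; `φ`, `Δ₀` enter without
conjugation, as they are real on the leaves).
[cite: Balaban1984PropagatorsI, (1.66) p.29 (the passage from (1.63) to the third expression)] -/
theorem sum_conj_mul_wSym (Δ₀ : ℂ) (dOne phiDir Bt : κ → ℂ) (hΔ : Δ₀ ≠ 0)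
    (hN : nSym dOne phiDir Δ₀ ≠ 0) :
    ∑ ka, conj (Bt ka) * wSym Δ₀ dOne phiDir Bt ka
      = (1 / 2) * ∑ mu, ∑ nu, (nSym dOne phiDir Δ₀ * Δ₀ ^ 2 * phiDir mu * phiDir nu)⁻¹
          * (conj (dOne mu * Bt nu - dOne nu * Bt mu) * (dOne mu * Bt nu - dOne nu * Bt mu)) := by
  set D := ∑ lam, (phiDir lam)⁻¹ * (conj (dOne lam) * dOne lam) with hD
  set SB := ∑ ka, (phiDir ka)⁻¹ * (conj (Bt ka) * Bt ka) with hSB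
  set T := ∑ mu, (phiDir mu)⁻¹ * (conj (dOne mu) * Bt mu) with hT
  set T' := ∑ nu, (phiDir nu)⁻¹ * (dOne nu * conj (Bt nu)) with hT'
  have hNsym : nSym dOne phiDir Δ₀ = (Δ₀ ^ 2)⁻¹ * D := by
    unfold nSym
    rw [hD, Finset.mul_sum]
    refine Finset.sum_congr rfl fun lam _ => ?_
    rw [normSq_eq_conj_mul_self]
    ring
  have hDne : D ≠ 0 := by
    intro h0
    apply hN
    rw [hNsym, h0, mul_zero]
  have htSum : tSum Δ₀ dOne phiDir Bt = Δ₀⁻¹ * T := by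
    unfold tSum
    rw [hT, Finset.mul_sum]
    exact Finset.sum_congr rfl fun lam _ => by ring
  have hLHS : ∑ ka, conj (Bt ka) * wSym Δ₀ dOne phiDir Bt ka
      = SB - (nSym dOne phiDir Δ₀)⁻¹ * tSum Δ₀ dOne phiDir Bt * (Δ₀⁻¹ * T') := by
    unfold wSym
    simp_rw [mul_sub]
    rw [Finset.sum_sub_distrib]
    congr 1
    · rw [hSB]
      exact Finset.sum_congr rfl fun ka _ => by ring
    · rw [hT', Finset.mul_sum, Finset.mul_sum]
      exact Finset.sum_congr rfl fun ka _ => by ring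
  have hlag : D * SB - T * T'
      = (1 / 2) * ∑ mu, ∑ nu, (phiDir mu)⁻¹ * (phiDir nu)⁻¹
          * (conj (dOne mu * Bt nu - dOne nu * Bt mu) * (dOne mu * Bt nu - dOne nu * Bt mu)) := by
    rw [hD, hSB, hT, hT']
    exact lagrange_weighted (fun ka => (phiDir ka)⁻¹) dOne Bt
  rw [hLHS, htSum, hNsym]
  have hΔ2 : Δ₀ ^ 2 ≠ 0 := pow_ne_zero 2 hΔ
  calc SB - ((Δ₀ ^ 2)⁻¹ * D)⁻¹ * (Δ₀⁻¹ * T) * (Δ₀⁻¹ * T')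
      = D⁻¹ * (D * SB - T * T') := by
        field_simp
    _ = D⁻¹ * ((1 / 2) * ∑ mu, ∑ nu, (phiDir mu)⁻¹ * (phiDir nu)⁻¹
          * (conj (dOne mu * Bt nu - dOne nu * Bt mu) * (dOne mu * Bt nu - dOne nu * Bt mu))) := by
        rw [hlag]
    _ = (1 / 2) * ∑ mu, ∑ nu, ((Δ₀ ^ 2)⁻¹ * D * Δ₀ ^ 2 * phiDir mu * phiDir nu)⁻¹
          * (conj (dOne mu * Bt nu - dOne nu * Bt mu) * (dOne mu * Bt nu - dOne nu * Bt mu)) := by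
        rw [mul_left_comm, Finset.mul_sum]
        refine congrArg _ (Finset.sum_congr rfl fun mu _ => ?_)
        rw [Finset.mul_sum]
        refine Finset.sum_congr rfl fun nu _ => ?_
        have hc : (Δ₀ ^ 2)⁻¹ * D * Δ₀ ^ 2 = D := by
          field_simp
        rw [hc, mul_inv, mul_inv]
        ring

end Agnostic

/-! ## §2 On the torus leaves: the weight is pv15's `w166` («the function under the integral in (1.66)») -/

section Torus

variable (n : ℕ) [NeZero n]

omit [NeZero n] in
/-- the (1.66) weight `w166 = [(Σ_κ|∂¹_κ|²/(Δ₀²φ_κ))·Δ₀φ_μ·Δ₀φ_ν]⁻¹` read in `ℂ` is `(N·Δ₀²·φ_μ·φ_ν)⁻¹` with the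
symbol `N = nSym` of (1.63). [cite: Balaban1984PropagatorsI, (1.66) p.29] -/
theorem w166_cast (s : Fin d → ℝ) (mu nu : Fin d) :
    ((w166 n mu nu s : ℝ) : ℂ)
      = (nSym (d1Sym s) (fun ka => ((phi162 n ka s : ℝ) : ℂ)) ((Delta1r 0 s : ℝ) : ℂ)
          * ((Delta1r 0 s : ℝ) : ℂ) ^ 2 * ((phi162 n mu s : ℝ) : ℂ) * ((phi162 n nu s : ℝ) : ℂ))⁻¹ := by
  have hN : nSym (d1Sym s) (fun ka => ((phi162 n ka s : ℝ) : ℂ)) ((Delta1r 0 s : ℝ) : ℂ)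
      = ((∑ ka, ‖d1Sym s ka‖ ^ 2 / (Delta1r 0 s ^ 2 * phi162 n ka s) : ℝ) : ℂ) := by
    unfold nSym
    push_cast
    refine Finset.sum_congr rfl fun ka _ => ?_
    rw [Complex.normSq_eq_norm_sq]
    push_cast
    rfl
  rw [hN, w166]
  push_cast
  ring

/-- the weight of the FIRST expression of (1.66), `φ_μ⁻¹φ_ν⁻¹(∂₁*φ⁻¹∂₁)⁻¹` at symbol level
(`(∂₁*φ⁻¹∂₁)(p′) = Σ_λ|∂¹_λ(p′)|²/φ_λ(p′)`), EQUALS the weight `w166` of the THIRD expression — the `Δ₀²`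
cancel (`p′ ≠ 0`). [cite: Balaban1984PropagatorsI, (1.66) p.29 (first = third expression)] -/
theorem w166_eq_first (hn : 1 ≤ n) (s : Fin d → ℝ) (hs : ∀ ν, |s ν| ≤ Real.pi) (ν₀ : Fin d)
    (hν₀ : s ν₀ ≠ 0) (mu nu : Fin d) :
    w166 n mu nu s
      = 1 / (phi162 n mu s * phi162 n nu s * ∑ lam, ‖d1Sym s lam‖ ^ 2 / phi162 n lam s) := by
  have hΔ : (0 : ℝ) < Delta1r 0 s := Delta1r_pos s hs ν₀ hν₀
  have hΔne : Delta1r 0 s ≠ 0 := hΔ.ne'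
  have hφ : ∀ ka, (0 : ℝ) < phi162 n ka s := fun ka => phi162_pos n hn ka s hs ν₀ hν₀
  unfold w166
  have hsum : ∑ ka, ‖d1Sym s ka‖ ^ 2 / (Delta1r 0 s ^ 2 * phi162 n ka s)
      = (Delta1r 0 s ^ 2)⁻¹ * ∑ lam, ‖d1Sym s lam‖ ^ 2 / phi162 n lam s := by
    rw [Finset.mul_sum]
    refine Finset.sum_congr rfl fun ka _ => ?_
    have hφk : phi162 n ka s ≠ 0 := (hφ ka).ne'
    field_simp
  rw [hsum]
  congr 1
  field_simp

/-- **on the torus leaves `p′ ≠ 0`: `Σ_κ B̄_κ w_κ(p′) = ½Σ_{μ,ν} w166(p′)·|∂¹_μ(p′)B_ν − ∂¹_ν(p′)B_μ|²`** with the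
typed symbols `∂¹ = d1Sym`, `φ = phi162` ((1.62)), `Δ₀ = Delta1r 0` and the symbol `wT` of `∂*∂H_kB`
(`B5Hk163RDiv.dftV_DstarD_HkOp_of_ne`). [cite: Balaban1984PropagatorsI, (1.66) p.29] -/
theorem sum_conj_mul_wT (hn : 1 ≤ n) (s : Fin d → ℝ) (hs : ∀ ν, |s ν| ≤ Real.pi) (ν₀ : Fin d)
    (hν₀ : s ν₀ ≠ 0) (Bt : Fin d → ℂ) :
    ∑ ka, conj (Bt ka) * wT n s Bt ka
      = (1 / 2) * ∑ mu, ∑ nu, ((w166 n mu nu s : ℝ) : ℂ)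
          * (normSq (d1Sym s mu * Bt nu - d1Sym s nu * Bt mu) : ℂ) := by
  have hΔ : (0 : ℝ) < Delta1r 0 s := Delta1r_pos s hs ν₀ hν₀
  have hφ : ∀ ka, (0 : ℝ) < phi162 n ka s := fun ka => phi162_pos n hn ka s hs ν₀ hν₀
  have hN := nSym_ne_zero (d1Sym s) (fun ka => phi162 n ka s) (Delta1r 0 s) hφ hΔ ν₀
    (d1Sym_ne_zero s hs ν₀ hν₀)
  have hΔc : ((Delta1r 0 s : ℝ) : ℂ) ≠ 0 := by exact_mod_cast hΔ.ne'
  unfold wT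
  rw [sum_conj_mul_wSym _ _ _ _ hΔc hN]
  refine congrArg _ (Finset.sum_congr rfl fun mu _ => Finset.sum_congr rfl fun nu _ => ?_)
  rw [w166_cast n s mu nu, normSq_eq_conj_mul_self]

end Torus

/-! ## §3 `⟨H_kB, ∂*∂H_kB⟩ = n^d·formDk(B)`: (1.65) = (1.66) for the typed (1.63)-operator -/

section Operator

variable (n : ℕ) [NeZero n] (M : Fin d → ℕ) [hM : ∀ μ, NeZero (M μ)]

/-- (1.61) AT `A := H_kB`, using `Q_kH_kB = B`: `Σ_l u(p′+l)v_κ(p′+l)(H_kB)^_κ(p′+l) = c_Q⁻¹·B̂_κ(p′)`.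
[cite: Balaban1984PropagatorsI, (1.61) p.28; p.29 «Q_kH_kB = B»] -/
theorem sum_uv_dft_HkOp (B : Tor M × Fin d → ℂ) (q : Tor M) (ka : Fin d) :
    ∑ k : Fin d → Fin n, uSym n k (sOf M q) * vSym n k (sOf M q) ka
        * (dft (fine n M) *ᵥ comp (fine n M) (HkOp n M *ᵥ B) ka) (pOf n M (k, q))
      = ((cQ n M : ℂ))⁻¹ * (dft M *ᵥ comp M B ka) q := by
  have h := dft_QvOp n M (HkOp n M *ᵥ B) q ka
  rw [QvOp_HkOp_mulVec] at h
  rw [h, ← mul_assoc, inv_mul_cancel₀ (cQ_ne_zero n M), one_mul]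

/-- the fibre sum over `p′ + l`, `l ∈ (2π/… )`, at a coarse momentum `p′ ≠ 0`:
`Σ_{l,κ} \overline{(H_kB)^_κ(p′+l)}·(∂*∂H_kB)^_κ(p′+l) = c_Q⁻²·Σ_κ \overline{B̂_κ(p′)}·w_κ(p′)`. [folklore] -/
theorem fiber_sum_of_ne (B : Tor M × Fin d → ℂ) {q : Tor M} (hq : q ≠ 0) :
    ∑ kκ : (Fin d → Fin n) × Fin d,
        star (dftV (fine n M) *ᵥ (HkOp n M *ᵥ B)) (pOf n M (kκ.1, q), kκ.2)
          * (dftV (fine n M) *ᵥ (DstarD n M *ᵥ (HkOp n M *ᵥ B))) (pOf n M (kκ.1, q), kκ.2)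
      = ((cQ n M : ℂ))⁻¹ ^ 2 * ∑ ka, conj ((dft M *ᵥ comp M B ka) q)
          * wT n (sOf M q) (fun lam => (dft M *ᵥ comp M B lam) q) ka := by
  rw [Fintype.sum_prod_type, Finset.sum_comm, Finset.mul_sum]
  refine Finset.sum_congr rfl fun ka _ => ?_
  have h1 : ∀ k : Fin d → Fin n,
      star (dftV (fine n M) *ᵥ (HkOp n M *ᵥ B)) (pOf n M (k, q), ka)
          * (dftV (fine n M) *ᵥ (DstarD n M *ᵥ (HkOp n M *ᵥ B))) (pOf n M (k, q), ka)
        = ((cQ n M : ℂ))⁻¹ * wT n (sOf M q) (fun lam => (dft M *ᵥ comp M B lam) q) ka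
            * conj (uSym n k (sOf M q) * vSym n k (sOf M q) ka
                * (dft (fine n M) *ᵥ comp (fine n M) (HkOp n M *ᵥ B) ka) (pOf n M (k, q))) := by
    intro k
    rw [dftV_DstarD_HkOp_of_ne n M B k hq ka, Pi.star_apply, B5DeltaA169.dftV_mulVec_apply,
      RCLike.star_def]
    simp only [map_mul]
    ring
  have hc : conj (((cQ n M : ℂ))⁻¹) = ((cQ n M : ℂ))⁻¹ := by
    rw [map_inv₀, Complex.conj_ofReal]
  rw [Finset.sum_congr rfl (fun k _ => h1 k), ← Finset.mul_sum, ← map_sum, sum_uv_dft_HkOp, map_mul, hc]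
  ring

/-- … and the fibre over `p′ = 0` contributes nothing (`(∂*∂H_kB)^(l) = 0`). [folklore] -/
theorem fiber_sum_zero (B : Tor M × Fin d → ℂ) :
    ∑ kκ : (Fin d → Fin n) × Fin d,
        star (dftV (fine n M) *ᵥ (HkOp n M *ᵥ B)) (pOf n M (kκ.1, 0), kκ.2)
          * (dftV (fine n M) *ᵥ (DstarD n M *ᵥ (HkOp n M *ᵥ B))) (pOf n M (kκ.1, 0), kκ.2) = 0 :=
  Finset.sum_eq_zero fun kκ _ => by rw [dftV_DstarD_HkOp_zero, mul_zero]

/-- the fibre sum at every coarse momentum, in pv15's vocabulary: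
`= c_Q⁻²·½Σ_{μ,ν} w166(p′)·|(∂₁B)~_{μν}(p′)|²` (`curlHat`; at `p′ = 0` both sides vanish). [folklore] -/
theorem fiber_sum_eq (B : Tor M × Fin d → ℂ) (q : Tor M) :
    ∑ kκ : (Fin d → Fin n) × Fin d,
        star (dftV (fine n M) *ᵥ (HkOp n M *ᵥ B)) (pOf n M (kκ.1, q), kκ.2)
          * (dftV (fine n M) *ᵥ (DstarD n M *ᵥ (HkOp n M *ᵥ B))) (pOf n M (kκ.1, q), kκ.2)
      = ((cQ n M : ℂ))⁻¹ ^ 2 * ((1 / 2) * ∑ mu, ∑ nu, ((w166 n mu nu (sOf M q) : ℝ) : ℂ)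
          * (normSq (curlHat M B mu nu q) : ℂ)) := by
  have hn : 1 ≤ n := Nat.one_le_iff_ne_zero.mpr (NeZero.ne n)
  rcases eq_or_ne q 0 with rfl | hq
  · rw [fiber_sum_zero]
    have h0 : ∀ mu nu, curlHat M B mu nu 0 = 0 := fun mu nu =>
      curlHat_eq_zero_of M B mu nu 0 (by rw [sOf_zero])
    simp [h0]
  · obtain ⟨ν₀, hν₀⟩ := Function.ne_iff.mp (sOf_ne_zero M hq)
    rw [fiber_sum_of_ne n M B hq, sum_conj_mul_wT n hn (sOf M q) (fun ν => abs_sOf_le M q ν) ν₀ hν₀]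
    rfl

/-- `c_Q⁻² = n^d` (`B5Block118.cQ_eq`, `Beta.Ineq167OperatorUpper.cQ_sq`). [folklore] -/
theorem cQ_inv_sq : ((cQ n M : ℂ))⁻¹ ^ 2 = ((n : ℂ)) ^ d := by
  rw [inv_pow, ← Complex.ofReal_pow, cQ_sq]
  push_cast
  rw [inv_inv]

/-- **(1.65) = (1.66) FOR THE TYPED (1.63)-OPERATOR `H_k`**: `⟨H_kB, ∂*∂H_kB⟩ = n^d · formDk n M B`, where
`∂*∂ = Δ − ∂∂*` (`B5Hk163RDiv.DstarD`, form `½Σ|F_{μν}|²`) and `formDk` is pv15's third expression of (1.66).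
«Using formulas (1.60) or (1.63) we obtain the following expression (1.66)» — kernel-certified.
[cite: Balaban1984PropagatorsI, (1.65)–(1.66) p.29] -/
theorem form_DstarD_HkOp (B : Tor M × Fin d → ℂ) :
    star (HkOp n M *ᵥ B) ⬝ᵥ (DstarD n M *ᵥ (HkOp n M *ᵥ B))
      = ((((n : ℝ) ^ d * formDk n M B : ℝ)) : ℂ) := by
  rw [← parseval_dftV n M (HkOp n M *ᵥ B) (DstarD n M *ᵥ (HkOp n M *ᵥ B))]
  have step1 : star (dftV (fine n M) *ᵥ (HkOp n M *ᵥ B)) ⬝ᵥ (dftV (fine n M) *ᵥ (DstarD n M *ᵥ (HkOp n M *ᵥ B)))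
      = ∑ q : Tor M, ∑ kκ : (Fin d → Fin n) × Fin d,
          star (dftV (fine n M) *ᵥ (HkOp n M *ᵥ B)) (pOf n M (kκ.1, q), kκ.2)
            * (dftV (fine n M) *ᵥ (DstarD n M *ᵥ (HkOp n M *ᵥ B))) (pOf n M (kκ.1, q), kκ.2) := by
    calc star (dftV (fine n M) *ᵥ (HkOp n M *ᵥ B)) ⬝ᵥ (dftV (fine n M) *ᵥ (DstarD n M *ᵥ (HkOp n M *ᵥ B)))
        = ∑ I, star (dftV (fine n M) *ᵥ (HkOp n M *ᵥ B)) I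
            * (dftV (fine n M) *ᵥ (DstarD n M *ᵥ (HkOp n M *ᵥ B))) I := rfl
      _ = ∑ J, star (dftV (fine n M) *ᵥ (HkOp n M *ᵥ B)) (B5Prop11Plancherel.emb n M J)
            * (dftV (fine n M) *ᵥ (DstarD n M *ᵥ (HkOp n M *ᵥ B))) (B5Prop11Plancherel.emb n M J) :=
          (Fintype.sum_bijective (B5Prop11Plancherel.emb n M) (B5Prop11Plancherel.emb_bijective n M) _ _
            (fun _ => rfl)).symm
      _ = ∑ kκ : (Fin d → Fin n) × Fin d, ∑ q : Tor M,
            star (dftV (fine n M) *ᵥ (HkOp n M *ᵥ B)) (pOf n M (kκ.1, q), kκ.2)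
              * (dftV (fine n M) *ᵥ (DstarD n M *ᵥ (HkOp n M *ᵥ B))) (pOf n M (kκ.1, q), kκ.2) := by
          rw [Fintype.sum_prod_type]
          rfl
      _ = _ := Finset.sum_comm
  have hform : ((formDk n M B : ℝ) : ℂ)
      = (1 / 2) * ∑ q : Tor M, ∑ mu, ∑ nu, ((w166 n mu nu (sOf M q) : ℝ) : ℂ)
          * (normSq (curlHat M B mu nu q) : ℂ) := by
    unfold formDk
    push_cast
    congr 1
    symm
    rw [Finset.sum_comm]
    refine Finset.sum_congr rfl fun mu _ => ?_
    rw [Finset.sum_comm]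
    refine Finset.sum_congr rfl fun nu _ => Finset.sum_congr rfl fun q _ => ?_
    rw [Complex.normSq_eq_norm_sq]
    push_cast
    ring
  rw [step1, Finset.sum_congr rfl (fun q _ => fiber_sum_eq n M B q), ← Finset.mul_sum, ← Finset.mul_sum,
    cQ_inv_sq, ← hform]
  push_cast
  ring

/-- **`½Σ_{x,μ,ν}|F^η_{μν}(H_kB)(x)|² = n^d·formDk(B)`** — the same in the curvature vocabulary of (1.21)
(`B5Hk163RDiv.form_DstarD`). [cite: Balaban1984PropagatorsI, (1.21) p.21, (1.65)–(1.66) p.29] -/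
theorem half_sum_Fs_HkOp (B : Tor M × Fin d → ℂ) :
    (1 / 2 : ℝ) * ∑ x, ∑ μ, ∑ ν, ‖Fs (fine n M) (n : ℂ) (HkOp n M *ᵥ B) μ ν x‖ ^ 2
      = (n : ℝ) ^ d * formDk n M B := by
  have h := form_DstarD_HkOp n M B
  rw [form_DstarD] at h
  exact_mod_cast h

/-- the (1.66)-form is dominated by the `η`-weighted curvature energy of EVERY fine field over `B`:
`formDk(B) ≤ n^{-d}·½Σ|F^η(A)|²` whenever `Q_kA = B` (the minimum property, `B5Hk163RDiv.HkOp_minimum_curvature`).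
[cite: Balaban1984PropagatorsI, p.29 (minimum property); (1.66)] -/
theorem formDk_le_of_QvOp_eq (B : Tor M × Fin d → ℂ) (A : Tor (fine n M) × Fin d → ℂ)
    (hA : QvOp n M *ᵥ A = B) :
    formDk n M B
      ≤ (1 / (n : ℝ) ^ d) * ((1 / 2 : ℝ) * ∑ x, ∑ μ, ∑ ν, ‖Fs (fine n M) (n : ℂ) A μ ν x‖ ^ 2) := by
  have hmin := (B5Hk163RDiv.HkOp_minimum_curvature n M B A hA).2
  have hnd : (0 : ℝ) < (n : ℝ) ^ d := by
    have : (0 : ℝ) < n := by exact_mod_cast Nat.pos_of_ne_zero (NeZero.ne n)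
    positivity
  have hH := half_sum_Fs_HkOp n M B
  have key : (n : ℝ) ^ d * formDk n M B
      ≤ (1 / 2 : ℝ) * ∑ x, ∑ μ, ∑ ν, ‖Fs (fine n M) (n : ℂ) A μ ν x‖ ^ 2 := by
    rw [← hH]
    exact mul_le_mul_of_nonneg_left hmin (by norm_num)
  have hnd' : (n : ℝ) ^ d ≠ 0 := hnd.ne'
  calc formDk n M B = (1 / (n : ℝ) ^ d) * ((n : ℝ) ^ d * formDk n M B) := by
        field_simp
    _ ≤ (1 / (n : ℝ) ^ d) * ((1 / 2 : ℝ) * ∑ x, ∑ μ, ∑ ν, ‖Fs (fine n M) (n : ℂ) A μ ν x‖ ^ 2) :=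
        mul_le_mul_of_nonneg_left key (by positivity)

end Operator

/-! ## §4 (1.63) = (1.103): the two typed `H_k` coincide -/

section Bridge

open scoped ComplexOrder

variable (n : ℕ) [NeZero n] (hn : 1 ≤ n) (M : Fin d → ℕ) [hM : ∀ μ, NeZero (M μ)] (a : ℝ) (ha : 0 < a)

/-- `‖CurlOp A‖² = 2·⟨A, ∂*∂A⟩` (`(CurlOp)ᴴ·CurlOp = 2(Δ − ∂∂*)`, `B5Action121.curl_adjoint_curl`). [folklore] -/
theorem curl_energy_eq_two_mul_form (A : Tor (fine n M) × Fin d → ℂ) :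
    star (CurlOp (fine n M) (n : ℂ) *ᵥ A) ⬝ᵥ (CurlOp (fine n M) (n : ℂ) *ᵥ A)
      = 2 * (star A ⬝ᵥ (DstarD n M *ᵥ A)) := by
  rw [star_mulVec_dotProduct, Matrix.mulVec_mulVec, curl_adjoint_curl, DstarD, Lap_eq_LapV,
    Matrix.smul_mulVec, dotProduct_smul, smul_eq_mul]

/-- **(1.63) = (1.103) on vectors**: `H^{(1.103)}_kB = H^{(1.63)}_kB` for every `B` and every `a > 0` —
`H^{(1.103)}B` lies on the printed hyperplane (`QvOp_Hk_mulVec`, `R_div_Hk_mulVec`) and minimises the curl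
energy over `{QA = B}` (`curl_energy_min`), so it is THE minimiser (`B5Hk163RDiv.HkOp_minimum_unique`).
[cite: Balaban1984PropagatorsI, p.33 «a calculation of H_kB. It is defined as a minimum … under the
conditions QA = B, R∂*A = 0»; (1.103) p.34; (1.63) p.28] -/
theorem Hk_mulVec_eq_HkOp_mulVec (B : Tor M × Fin d → ℂ) :
    Hk n hn M a ha *ᵥ B = HkOp n M *ᵥ B := by
  refine HkOp_minimum_unique n M B (Hk n hn M a ha *ᵥ B) (QvOp_Hk_mulVec n hn M a ha B)
    (R_div_Hk_mulVec n hn M a ha B) ?_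
  have h := curl_energy_min n hn M a ha (HkOp n M *ᵥ B) B (QvOp_HkOp_mulVec n M B)
  have h2 : ∀ z : ℂ, ((2 : ℂ) * z).re = 2 * z.re := fun z => by simp [Complex.mul_re]
  rw [curl_energy_eq_two_mul_form, curl_energy_eq_two_mul_form, h2, h2] at h
  linarith

/-- **`B5Hk163Torus.HkOp n M = Beta.FluctuationProjection.Hk n hn M a ha`** — the momentum representation
(1.63) and the representation (1.103) `GQ*(QGQ*)⁻¹` define the same operator `H_k`, for every `a > 0`.
[cite: Balaban1984PropagatorsI, (1.63) p.28, (1.103) p.34] -/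
theorem HkOp_eq_Hk : HkOp n M = Hk n hn M a ha := by
  refine Matrix.toLin'.injective (LinearMap.ext fun B => ?_)
  rw [Matrix.toLin'_apply, Matrix.toLin'_apply, Hk_mulVec_eq_HkOp_mulVec]

end Bridge

/-! ## §5 The (1.65)↔(1.66) dictionary: `⟨B, Δ_kB⟩ = formDk(B)` and the two carriers coincide -/

section Dictionary

variable (n : ℕ) [NeZero n] (hn : 1 ≤ n) (M : Fin d → ℕ) [hM : ∀ μ, NeZero (M μ)] (a : ℝ) (ha : 0 < a)

/-- **THE (1.65)↔(1.66) DICTIONARY: `Bᴴ·Δ_k·B = formDk n M B`** — the GENUINE operator of (1.65)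
(`Beta.BlockEffectiveAction.DelK`) has the (1.66)-form of pv15 as its quadratic form, exactly (the weight
`η^d = n^{-d}` of (1.21) cancels the DFT ratio `c_Q⁻² = n^d`).
[cite: Balaban1984PropagatorsI, (1.65)–(1.66) p.29] -/
theorem DelK_form_eq_formDk (B : Tor M × Fin d → ℂ) :
    star B ⬝ᵥ (DelK n hn M a ha *ᵥ B) = ((formDk n M B : ℝ) : ℂ) := by
  have hnd : (n : ℝ) ^ d ≠ 0 := pow_ne_zero _ (Nat.cast_ne_zero.mpr (NeZero.ne n))
  have key : (1 / 2 * (1 / (n : ℝ) ^ d)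
        * ∑ x, ∑ μ, ∑ ν, ‖Fs (fine n M) (n : ℂ) (HkOp n M *ᵥ B) μ ν x‖ ^ 2 : ℝ) = formDk n M B := by
    calc (1 / 2 * (1 / (n : ℝ) ^ d) * ∑ x, ∑ μ, ∑ ν, ‖Fs (fine n M) (n : ℂ) (HkOp n M *ᵥ B) μ ν x‖ ^ 2 : ℝ)
        = (1 / (n : ℝ) ^ d)
            * ((1 / 2 : ℝ) * ∑ x, ∑ μ, ∑ ν, ‖Fs (fine n M) (n : ℂ) (HkOp n M *ᵥ B) μ ν x‖ ^ 2) := by ring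
      _ = (1 / (n : ℝ) ^ d) * ((n : ℝ) ^ d * formDk n M B) := by rw [half_sum_Fs_HkOp]
      _ = formDk n M B := by field_simp
  rw [DelK_form_eq, Hk_mulVec_eq_HkOp_mulVec, key]

/-- `Re⟨B, Δ_kB⟩ = formDk n M B`. [cite: Balaban1984PropagatorsI, (1.65)–(1.66) p.29] -/
theorem DelK_form_re_eq_formDk (B : Tor M × Fin d → ℂ) :
    (star B ⬝ᵥ (DelK n hn M a ha *ᵥ B)).re = formDk n M B := by
  rw [DelK_form_eq_formDk, Complex.ofReal_re]

/-- **THE TWO (1.64)–(1.67) CARRIERS OF THE PACKAGE COINCIDE**: the β cell's `formOfDelK` (whose `formΔk` is the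
GENUINE `Re⟨B, Δ_kB⟩` of (1.65)) EQUALS pv15's `formOfLattice` (whose `formΔk` is the (1.66)-DEFINED `formDk`).
[cite: Balaban1984PropagatorsI, (1.64)–(1.67) p.29 (packaging ours)] -/
theorem formOfDelK_eq_formOfLattice : formOfDelK n hn M a ha = formOfLattice n M := by
  unfold formOfDelK formOfLattice
  congr 1
  funext B
  exact DelK_form_re_eq_formDk n hn M a ha B

/-- (1.67) for the genuine `Δ_k` OBTAINED THROUGH (1.66) (pv15's `ineq167` transported by the dictionary):
`(4/π²)^{d+2}⟨∂₁B,∂₁B⟩ ≤ Re⟨B,Δ_kB⟩ ≤ (π²/4)^{2d+4}⟨∂₁B,∂₁B⟩`.  The β cell's `ineq167_DelK` has the SHARPER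
constants `1` and `(π²/4)^{d+2}`; this is recorded only as the literal (1.66) road of the paper.
[cite: Balaban1984PropagatorsI, (1.67) p.29] -/
theorem ineq167_DelK_via166 (B : Tor M × Fin d → ℂ) :
    (4 / Real.pi ^ 2) ^ (d + 2) * d1Sq M B ≤ (star B ⬝ᵥ (DelK n hn M a ha *ᵥ B)).re
      ∧ (star B ⬝ᵥ (DelK n hn M a ha *ᵥ B)).re ≤ (Real.pi ^ 2 / 4) ^ (2 * d + 4) * d1Sq M B := by
  rw [DelK_form_re_eq_formDk]
  exact ineq167 n M hn B

include hn in
/-- both certified pairs of constants at once: `max(1·, (4/π²)^{d+2}·)⟨∂₁B,∂₁B⟩ ≤ formDk(B) = Re⟨B,Δ_kB⟩ ≤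
min((π²/4)^{d+2}, (π²/4)^{2d+4})·⟨∂₁B,∂₁B⟩`, i.e. pv15's (1.66)-form obeys the β cell's sharper (1.67):
`d1Sq ≤ formDk ≤ (π²/4)^{d+2}·d1Sq`. [cite: Balaban1984PropagatorsI, (1.67) p.29 (constants ours)] -/
theorem ineq167_formDk_sharp (B : Tor M × Fin d → ℂ) :
    d1Sq M B ≤ formDk n M B ∧ formDk n M B ≤ gamma1 d * d1Sq M B := by
  have h := ineq167_DelK n hn M 1 one_pos B
  rwa [DelK_form_re_eq_formDk] at h

end Dictionary

end Literature.MathematicalPhysics.QuantumFieldTheory.Balaban1983to89.B5Hk163Form166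

end
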